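import Mathlib
import Literature.NumberTheory.Transcendental.KZCalculus
import Literature.NumberTheory.Transcendental.KZLogCalculusProofs
import Literature.NumberTheory.Transcendental.KZGroundingRelations
import Literature.NumberTheory.Transcendental.KZSemialgebraicComplex
import Summits.KontsevichZagierPeriods.KontsevichZagierPeriods.Theses.UnfoldedStokes
import Summits.KontsevichZagierPeriods.KontsevichZagierPeriods.Theorems.UnfoldedStokesHyperellipticRiemannRelationStubFacesGaps
import Summits.KontsevichZagierPeriods.KontsevichZagierPeriods.Theorems.UnfoldedStokesHyperellipticRiemannRelationStubFacesReps

/-!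
# `HyperellipticRiemannRelation` (stmt-KontsevichZagierPeriods-3522), line `SketchIdeator2`:
# stub `stub_faces` — the two bottom faces cut along the gap grid

Registered stub `stub_faces` of the line skeleton. With `Φ(z) = ∏ⱼ √(z − eⱼ)`, the six gaps
`J₀,…,J₅` of the branch points `e₀ < ⋯ < e₄`, `f(x) = x₁/√(|P(x₀)||P(x₁)|)` and ONE global
representation `G₂ = [(ℝ∖E)², f]`:

* (I) the simplex face `[{u>0, τ∉E, τ−u∉E}, Im(τ/(Φ(τ−u)Φ(τ)))]` exists and differs from the
  nine-term combination `−P₀₁ + P₀₃ − P₀₅ + P₁₂ − P₁₄ − P₂₃ + P₂₅ + P₃₄ − P₄₅` of the boxes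
  `P_{jk} = [J_j × J_k, f]` by a relation;
* (II) for each gap `J_L` the column face `[J_L × (ℝ∖E), ρ(x₀) Re(x₁/Φ(x₁))]`, `ρ = 1/√|P|`,
  exists and differs from `P_{L1} − P_{L3} + P_{L5}` by a relation.

Chain of moves. The boundary phases `1/Φ = ε_k/√|P|` on `J_k`, `ε = (−i,1,i,−1,−i,1)`
(`Faces.inv_Phi_gap`), make both face integrands INTEGER multiples of `f` on every cell
`J_j × J_k` of the gap grid (`Faces.im_kernel_cell`, `Faces.re_kernel_col`), so the faces are
representations built from `G₂` cell by cell (`Faces.exists_rep_piecewise`). (I): the shear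
`(u,τ) ↦ (τ−u, τ)` is ONE rule-(2) move onto `[{x₀<x₁}∖lines, Im(x₁/(Φ(x₀)Φ(x₁)))]`
(`stub_facesReps`); cutting along the 36 cells (rule (1a), `Faces.of_sub_sum_cells_mem_relations`)
leaves the nine cross-parity boxes `j < k`, `Im(ε_j ε_k) = ±1`, which are `±P_{jk}` by congruence
(`KZ.of_sub_of_mem_relations_of_eqOn`, `KZ.of_add_of_mem_relations_of_eqOn_neg`); the other cells
carry the zero integrand or are empty (`KZ.of_mem_relations_of_eqOn_zero`). (II): cut along the six
columns `J_L × J_k`; `Re ε = (0,1,0,−1,0,1)`.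

No definitions are introduced. References: Kontsevich–Zagier 2001, §1.2 rules (1), (2);
Bochnak–Coste–Roy 1998, §2.2.
-/

noncomputable section

namespace Summit.KontsevichZagierPeriods.UnfoldedStokes.HyperellipticRiemannRelationLine

open Set MeasureTheory Filter Topology
open Literature.NumberTheory.Transcendental
open Literature.ModelTheory.ExponentialFields (IsSemialgebraic)

/-- **Faces.** On the gap `J_k` (`k` roots to the left) `1/Φ(x) = εₖ/√|P(x)|` with
`ε = (−i, 1, i, −1, −i, 1)` (`√(negative) = i √|·|`).  (I) Simplex face: the shear
`(u,τ) ↦ (x₀,x₁) = (τ−u, τ)` (rule 2, Jacobian 1) carries the base `{u>0, τ∉E, τ−u∉E}` with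
integrand `Im K(τ−u,τ,0)` onto `{x₀<x₁} \ lines` with integrand `Im(x₁/(Φ(x₀)Φ(x₁)))`, which domain
additivity (rule 1) over the 15 boxes `Jⱼ×Jₖ` (`j<k`) and 6 triangles splits into the nine cross-type
boxes with signs `Im(εⱼεₖ)` — the same-type pieces carry the zero integrand — all pieces being
restrictions of ONE global representation `G₂ = [(ℝ\E)², x₁/√(|P(x₀)||P(x₁)|)]`. (II) Column face:
`[J_L × (ℝ\E), ρ(x₀) Re(x₁/Φ(x₁))]` splits into `+[J_L×J₁] − [J_L×J₃] + [J_L×J₅]` (real phases) and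
three zero pieces. [cite: KontsevichZagier2001, §1.2 rules (1), (2)] -/
theorem stub_faces :
    ∀ (e : Fin 5 → ℚ), StrictMono e →
    ∀ (Φ : ℂ → ℂ), (∀ z, Φ z = ∏ j : Fin 5, Complex.sqrt (z - ((e j : ℝ) : ℂ))) →
    ∀ (J : Fin 6 → Set ℝ), J = ![Set.Iio (e 0 : ℝ), Set.Ioo (e 0 : ℝ) (e 1 : ℝ),
        Set.Ioo (e 1 : ℝ) (e 2 : ℝ), Set.Ioo (e 2 : ℝ) (e 3 : ℝ), Set.Ioo (e 3 : ℝ) (e 4 : ℝ),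
        Set.Ioi (e 4 : ℝ)] →
    ∀ (f : (Fin 2 → ℝ) → ℝ), (∀ x, f x =
        x 1 / Real.sqrt (|∏ i : Fin 5, (x 0 - (e i : ℝ))| * |∏ i : Fin 5, (x 1 - (e i : ℝ))|)) →
    ∀ (G₂ : KZ.IntegralRep 2), G₂.domain = {x | ∀ j, x 0 ≠ (e j : ℝ) ∧ x 1 ≠ (e j : ℝ)} →
      G₂.integrand = f →
    (∀ (p01 p03 p05 p12 p14 p23 p25 p34 p45 : KZ.IntegralRep 2),
      (p01.domain = {x | x 0 ∈ J 0 ∧ x 1 ∈ J 1} ∧ p01.integrand = f) →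
      (p03.domain = {x | x 0 ∈ J 0 ∧ x 1 ∈ J 3} ∧ p03.integrand = f) →
      (p05.domain = {x | x 0 ∈ J 0 ∧ x 1 ∈ J 5} ∧ p05.integrand = f) →
      (p12.domain = {x | x 0 ∈ J 1 ∧ x 1 ∈ J 2} ∧ p12.integrand = f) →
      (p14.domain = {x | x 0 ∈ J 1 ∧ x 1 ∈ J 4} ∧ p14.integrand = f) →
      (p23.domain = {x | x 0 ∈ J 2 ∧ x 1 ∈ J 3} ∧ p23.integrand = f) →
      (p25.domain = {x | x 0 ∈ J 2 ∧ x 1 ∈ J 5} ∧ p25.integrand = f) →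
      (p34.domain = {x | x 0 ∈ J 3 ∧ x 1 ∈ J 4} ∧ p34.integrand = f) →
      (p45.domain = {x | x 0 ∈ J 4 ∧ x 1 ∈ J 5} ∧ p45.integrand = f) →
      ∃ F : KZ.IntegralRep 2,
        F.domain = {y : Fin 2 → ℝ | 0 < y 0 ∧ ∀ j, y 1 ≠ (e j : ℝ) ∧ y 1 - y 0 ≠ (e j : ℝ)} ∧
        EqOn F.integrand
          (fun y => (((y 1 : ℝ) : ℂ) / (Φ ((y 1 - y 0 : ℝ) : ℂ) * Φ ((y 1 : ℝ) : ℂ))).im)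
          {y : Fin 2 → ℝ | 0 < y 0 ∧ ∀ j, y 1 ≠ (e j : ℝ) ∧ y 1 - y 0 ≠ (e j : ℝ)} ∧
        KZ.of F - (-KZ.of p01 + KZ.of p03 - KZ.of p05 + KZ.of p12 - KZ.of p14 - KZ.of p23
          + KZ.of p25 + KZ.of p34 - KZ.of p45) ∈ KZ.relations) ∧
    (∀ (ρ : ℝ → ℝ), (∀ t, ρ t = 1 / Real.sqrt |∏ i : Fin 5, (t - (e i : ℝ))|) →
      ∀ (L : Fin 6) (q1 q3 q5 : KZ.IntegralRep 2),
      (q1.domain = {x | x 0 ∈ J L ∧ x 1 ∈ J 1} ∧ q1.integrand = f) →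
      (q3.domain = {x | x 0 ∈ J L ∧ x 1 ∈ J 3} ∧ q3.integrand = f) →
      (q5.domain = {x | x 0 ∈ J L ∧ x 1 ∈ J 5} ∧ q5.integrand = f) →
      ∃ Fc : KZ.IntegralRep 2,
        Fc.domain = {y : Fin 2 → ℝ | y 0 ∈ J L ∧ ∀ j, y 1 ≠ (e j : ℝ)} ∧
        EqOn Fc.integrand (fun y => ρ (y 0) * (((y 1 : ℝ) : ℂ) / Φ ((y 1 : ℝ) : ℂ)).re)
          {y : Fin 2 → ℝ | y 0 ∈ J L ∧ ∀ j, y 1 ≠ (e j : ℝ)} ∧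
        KZ.of Fc - (KZ.of q1 - KZ.of q3 + KZ.of q5) ∈ KZ.relations) := by
  intro e he Φ hΦ J hJ f hf G₂ hG₂d hG₂i
  /- the cells `J_j × J_k` of the gap grid -/
  obtain ⟨C, hC⟩ : ∃ C : Fin 6 × Fin 6 → Set (Fin 2 → ℝ),
      ∀ jk, C jk = {x | x 0 ∈ J jk.1 ∧ x 1 ∈ J jk.2} := ⟨_, fun _ => rfl⟩
  have hCsa : ∀ jk, IsSemialgebraic ℚ (C jk) := fun jk => by
    rw [hC, setOf_and]
    exact (Faces.isSemialgebraic_gap e J hJ jk.1 (0 : Fin 2)).inter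
      (Faces.isSemialgebraic_gap e J hJ jk.2 (1 : Fin 2))
  have hCG : ∀ jk, C jk ⊆ G₂.domain := fun jk x hx => by
    rw [hC] at hx
    rw [hG₂d]
    exact fun i => ⟨Faces.gap_ne e he J hJ hx.1 i, Faces.gap_ne e he J hJ hx.2 i⟩
  have hGcov : G₂.domain ⊆ ⋃ jk, C jk := fun x hx => by
    rw [hG₂d] at hx
    obtain ⟨j, hj⟩ := Faces.gap_cover e J hJ fun i => (hx i).1
    obtain ⟨k, hk⟩ := Faces.gap_cover e J hJ fun i => (hx i).2
    exact mem_iUnion.mpr ⟨(j, k), by rw [hC]; exact ⟨hj, hk⟩⟩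
  have hCdisj : ∀ i j, i ≠ j → C i ∩ C j = ∅ := fun i j hij => by
    refine eq_empty_of_forall_notMem fun x hx => hij ?_
    rw [mem_inter_iff, hC, hC] at hx
    exact Prod.ext (Faces.gap_unique e he J hJ hx.1.1 hx.2.1)
      (Faces.gap_unique e he J hJ hx.1.2 hx.2.2)
  refine ⟨?_, ?_⟩
  · /- (I) the simplex face -/
    intro p01 p03 p05 p12 p14 p23 p25 p34 p45 h01 h03 h05 h12 h14 h23 h25 h34 h45
    -- the representation `[(ℝ∖E)², Im(x₁/(Φ(x₀)Φ(x₁)))]`, built cell by cell from `G₂`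
    obtain ⟨H₀, hH₀d, hH₀i⟩ := Faces.exists_rep_piecewise G₂ C hCsa hCG hGcov
      (fun x => (((x 1 : ℝ) : ℂ) / (Φ ((x 0 : ℝ) : ℂ) * Φ ((x 1 : ℝ) : ℂ))).im) fun jk => by
        obtain ⟨n, hn⟩ := Faces.phase_im_int jk.1 jk.2
        refine ⟨n, fun x hx => ?_⟩
        rw [hC] at hx
        simp only [hG₂i]
        rw [Faces.im_kernel_cell e he Φ hΦ J hJ f hf hx.1 hx.2, ← hn]
    -- its restriction `H` to the cut simplex `S = {x₀ < x₁} ∖ lines`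
    obtain ⟨S, hS⟩ : ∃ S : Set (Fin 2 → ℝ),
        S = {x | x 0 < x 1 ∧ ∀ j, x 0 ≠ (e j : ℝ) ∧ x 1 ≠ (e j : ℝ)} := ⟨_, rfl⟩
    have hSsa : IsSemialgebraic ℚ S := by
      have hlt : IsSemialgebraic ℚ {x : Fin 2 → ℝ | x 0 < x 1} := by
        simpa using Literature.ModelTheory.ExponentialFields.isSemialgebraic_setOf_eval_lt
          (k := ℚ) (R := ℝ) (MvPolynomial.X (0 : Fin 2)) (MvPolynomial.X 1)
      rw [hS, setOf_and, ← hG₂d]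
      exact hlt.inter G₂.isSemialgebraic_domain
    have hSG : S ⊆ H₀.domain := fun x hx => by
      rw [hH₀d, hG₂d]
      rw [hS] at hx
      exact hx.2
    obtain ⟨H, hHd, hHi⟩ : ∃ H : KZ.IntegralRep 2, H.domain = S ∧
        H.integrand = fun x => (((x 1 : ℝ) : ℂ) / (Φ ((x 0 : ℝ) : ℂ) * Φ ((x 1 : ℝ) : ℂ))).im :=
      ⟨H₀.restrict S hSsa hSG, rfl, hH₀i⟩
    -- the shear: ONE change of variables
    obtain ⟨F, hFd, hFi, hFH⟩ := stub_facesReps e H (hHd.trans hS)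
    refine ⟨F, hFd, fun y _ => ?_, ?_⟩
    · rw [hFi]
      simp only [hHi, Matrix.cons_val_one, Matrix.cons_val_zero]
    -- cut `H` along the 36 cells
    obtain ⟨R, hRd, hRi⟩ : ∃ R : Fin 6 × Fin 6 → KZ.IntegralRep 2,
        (∀ jk, (R jk).domain = H.domain ∩ C jk) ∧ ∀ jk, (R jk).integrand = H.integrand :=
      ⟨fun jk => H.restrict _ (H.isSemialgebraic_domain.inter (hCsa jk)) inter_subset_left,
        fun _ => rfl, fun _ => rfl⟩
    have hcov : H.domain ⊆ ⋃ jk, C jk := fun x hx => by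
      rw [hHd] at hx
      exact hGcov (hH₀d ▸ hSG hx)
    have hcut := Faces.of_sub_sum_cells_mem_relations H C R hRd hRi hcov hCdisj
    -- membership in a cell of `H`
    have hmem : ∀ jk x, x ∈ (R jk).domain → x 0 < x 1 ∧ x 0 ∈ J jk.1 ∧ x 1 ∈ J jk.2 := by
      intro jk x hx
      rw [hRd, hHd, hS, hC] at hx
      exact ⟨hx.1.1, hx.2.1, hx.2.2⟩
    -- the nine cross-parity boxes
    obtain ⟨B, hB⟩ : ∃ B : Finset (Fin 6 × Fin 6),
        B = {(0, 1), (0, 3), (0, 5), (1, 2), (1, 4), (2, 3), (2, 5), (3, 4), (4, 5)} := ⟨_, rfl⟩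
    have htri : ∀ j k : Fin 6, (j, k) ∈ B ∨ k < j ∨
        ((![-Complex.I, 1, Complex.I, -1, -Complex.I, 1] : Fin 6 → ℂ) j *
          (![-Complex.I, 1, Complex.I, -1, -Complex.I, 1] : Fin 6 → ℂ) k).im = 0 := by
      intro j k
      rw [hB]
      fin_cases j <;> fin_cases k <;> simp
    -- the other cells carry the zero integrand (or are empty)
    have hzero : ∀ jk, jk ∉ B → KZ.of (R jk) ∈ KZ.relations := by
      rintro ⟨j, k⟩ hjk
      refine KZ.of_mem_relations_of_eqOn_zero _ fun x hx => ?_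
      obtain ⟨hlt, h0, h1⟩ := hmem (j, k) x hx
      rw [hRi, hHi]
      simp only [Pi.zero_apply]
      rw [Faces.im_kernel_cell e he Φ hΦ J hJ f hf h0 h1]
      rcases htri j k with h | h | h
      · exact absurd h hjk
      · exact absurd (Faces.gap_lt e he J hJ h h1 h0) (not_lt.mpr hlt.le)
      · rw [h, zero_mul]
    have hBc : ∑ jk ∈ Bᶜ, KZ.of (R jk) ∈ KZ.relations :=
      sum_mem fun jk hjk => hzero jk (Finset.mem_compl.mp hjk)
    -- the cross-parity boxes are `± P_{jk}`
    have hcross : ∀ (j k : Fin 6) (p : KZ.IntegralRep 2), j < k →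
        p.domain = {x | x 0 ∈ J j ∧ x 1 ∈ J k} → p.integrand = f →
        ((((![-Complex.I, 1, Complex.I, -1, -Complex.I, 1] : Fin 6 → ℂ) j *
            (![-Complex.I, 1, Complex.I, -1, -Complex.I, 1] : Fin 6 → ℂ) k).im = 1 →
          KZ.of (R (j, k)) - KZ.of p ∈ KZ.relations) ∧
        (((![-Complex.I, 1, Complex.I, -1, -Complex.I, 1] : Fin 6 → ℂ) j *
            (![-Complex.I, 1, Complex.I, -1, -Complex.I, 1] : Fin 6 → ℂ) k).im = -1 →
          KZ.of (R (j, k)) + KZ.of p ∈ KZ.relations)) := by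
      intro j k p hjk hpd hpi
      have hdom : p.domain = (R (j, k)).domain := by
        rw [hpd, hRd, hHd, hS, hC]
        ext x
        simp only [mem_setOf_eq, mem_inter_iff]
        constructor
        · intro hx
          exact ⟨⟨Faces.gap_lt e he J hJ hjk hx.1 hx.2, fun i =>
            ⟨Faces.gap_ne e he J hJ hx.1 i, Faces.gap_ne e he J hJ hx.2 i⟩⟩, hx⟩
        · intro hx
          exact hx.2
      refine ⟨fun hs => KZ.of_sub_of_mem_relations_of_eqOn hdom fun x hx => ?_,
        fun hs => KZ.of_add_of_mem_relations_of_eqOn_neg hdom fun x hx => ?_⟩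
      · obtain ⟨-, h0, h1⟩ := hmem (j, k) x hx
        rw [hRi, hHi, hpi]
        simp only
        rw [Faces.im_kernel_cell e he Φ hΦ J hJ f hf h0 h1, hs, one_mul]
      · obtain ⟨-, h0, h1⟩ := hmem (j, k) x hx
        rw [hRi, hHi, hpi]
        simp only [Pi.neg_apply]
        rw [Faces.im_kernel_cell e he Φ hΦ J hJ f hf h0 h1, hs]
        ring
    have r01 := (hcross 0 1 p01 (by decide) h01.1 h01.2).2 (by simp)
    have r03 := (hcross 0 3 p03 (by decide) h03.1 h03.2).1 (by simp)
    have r05 := (hcross 0 5 p05 (by decide) h05.1 h05.2).2 (by simp)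
    have r12 := (hcross 1 2 p12 (by decide) h12.1 h12.2).1 (by simp)
    have r14 := (hcross 1 4 p14 (by decide) h14.1 h14.2).2 (by simp)
    have r23 := (hcross 2 3 p23 (by decide) h23.1 h23.2).2 (by simp)
    have r25 := (hcross 2 5 p25 (by decide) h25.1 h25.2).1 (by simp)
    have r34 := (hcross 3 4 p34 (by decide) h34.1 h34.2).1 (by simp)
    have r45 := (hcross 4 5 p45 (by decide) h45.1 h45.2).2 (by simp)
    -- bookkeeping in the free abelian group
    have key : KZ.of F - (-KZ.of p01 + KZ.of p03 - KZ.of p05 + KZ.of p12 - KZ.of p14 - KZ.of p23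
        + KZ.of p25 + KZ.of p34 - KZ.of p45) =
        (KZ.of F - KZ.of H) + (KZ.of H - ∑ jk, KZ.of (R jk)) + ∑ jk ∈ Bᶜ, KZ.of (R jk) +
        ((KZ.of (R (0, 1)) + KZ.of p01) + (KZ.of (R (0, 3)) - KZ.of p03) +
          (KZ.of (R (0, 5)) + KZ.of p05) + (KZ.of (R (1, 2)) - KZ.of p12) +
          (KZ.of (R (1, 4)) + KZ.of p14) + (KZ.of (R (2, 3)) + KZ.of p23) +
          (KZ.of (R (2, 5)) - KZ.of p25) + (KZ.of (R (3, 4)) - KZ.of p34) +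
          (KZ.of (R (4, 5)) + KZ.of p45)) := by
      rw [← Finset.sum_add_sum_compl B (fun jk => KZ.of (R jk)), hB,
        Finset.sum_insert (by decide), Finset.sum_insert (by decide),
        Finset.sum_insert (by decide), Finset.sum_insert (by decide),
        Finset.sum_insert (by decide), Finset.sum_insert (by decide),
        Finset.sum_insert (by decide), Finset.sum_insert (by decide), Finset.sum_singleton]
      abel
    rw [key]
    refine KZ.relations.add_mem (KZ.relations.add_mem (KZ.relations.add_mem hFH hcut) hBc) ?_
    exact KZ.relations.add_mem (KZ.relations.add_mem (KZ.relations.add_mem (KZ.relations.add_mem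
      (KZ.relations.add_mem (KZ.relations.add_mem (KZ.relations.add_mem (KZ.relations.add_mem
      r01 r03) r05) r12) r14) r23) r25) r34) r45
  · /- (II) the column faces -/
    intro ρ hρ L q1 q3 q5 hq1 hq3 hq5
    -- the representation `[(ℝ∖E)², ρ(x₀) Re(x₁/Φ(x₁))]`, built cell by cell from `G₂`
    obtain ⟨H₁, hH₁d, hH₁i⟩ := Faces.exists_rep_piecewise G₂ C hCsa hCG hGcov
      (fun y => ρ (y 0) * (((y 1 : ℝ) : ℂ) / Φ ((y 1 : ℝ) : ℂ)).re) fun jk => by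
        obtain ⟨n, hn⟩ := Faces.phase_re_int jk.2
        refine ⟨n, fun x hx => ?_⟩
        rw [hC] at hx
        simp only [hG₂i]
        rw [Faces.re_kernel_col e he Φ hΦ J hJ f hf ρ hρ hx.2, ← hn]
    -- its restriction `Fc` to the column base `T = J_L × (ℝ ∖ E)`
    obtain ⟨T, hT⟩ : ∃ T : Set (Fin 2 → ℝ), T = {y | y 0 ∈ J L ∧ ∀ j, y 1 ≠ (e j : ℝ)} :=
      ⟨_, rfl⟩
    have hTeq : T = {y : Fin 2 → ℝ | y 0 ∈ J L} ∩ G₂.domain := by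
      rw [hT, hG₂d]
      ext y
      simp only [mem_setOf_eq, mem_inter_iff]
      constructor
      · intro hy
        exact ⟨hy.1, fun i => ⟨Faces.gap_ne e he J hJ hy.1 i, hy.2 i⟩⟩
      · intro hy
        exact ⟨hy.1, fun i => (hy.2 i).2⟩
    have hTsa : IsSemialgebraic ℚ T := by
      rw [hTeq]
      exact (Faces.isSemialgebraic_gap e J hJ L (0 : Fin 2)).inter G₂.isSemialgebraic_domain
    have hTG : T ⊆ H₁.domain := fun y hy => by
      rw [hH₁d]
      rw [hTeq] at hy
      exact hy.2
    obtain ⟨Fc, hFcd, hFci⟩ : ∃ Fc : KZ.IntegralRep 2, Fc.domain = T ∧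
        Fc.integrand = fun y => ρ (y 0) * (((y 1 : ℝ) : ℂ) / Φ ((y 1 : ℝ) : ℂ)).re :=
      ⟨H₁.restrict T hTsa hTG, rfl, hH₁i⟩
    refine ⟨Fc, hFcd.trans hT, fun y _ => by rw [hFci], ?_⟩
    -- cut `Fc` along the six columns
    obtain ⟨C', hC'⟩ : ∃ C' : Fin 6 → Set (Fin 2 → ℝ), ∀ k, C' k = {y | y 1 ∈ J k} :=
      ⟨_, fun _ => rfl⟩
    have hC'sa : ∀ k, IsSemialgebraic ℚ (C' k) := fun k => by
      rw [hC']
      exact Faces.isSemialgebraic_gap e J hJ k (1 : Fin 2)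
    obtain ⟨R, hRd, hRi⟩ : ∃ R : Fin 6 → KZ.IntegralRep 2,
        (∀ k, (R k).domain = Fc.domain ∩ C' k) ∧ ∀ k, (R k).integrand = Fc.integrand :=
      ⟨fun k => Fc.restrict _ (Fc.isSemialgebraic_domain.inter (hC'sa k)) inter_subset_left,
        fun _ => rfl, fun _ => rfl⟩
    have hcov : Fc.domain ⊆ ⋃ k, C' k := fun y hy => by
      rw [hFcd, hT] at hy
      obtain ⟨k, hk⟩ := Faces.gap_cover e J hJ hy.2
      exact mem_iUnion.mpr ⟨k, by rw [hC']; exact hk⟩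
    have hdisj : ∀ i j, i ≠ j → C' i ∩ C' j = ∅ := fun i j hij => by
      refine eq_empty_of_forall_notMem fun x hx => hij ?_
      rw [mem_inter_iff, hC', hC'] at hx
      exact Faces.gap_unique e he J hJ hx.1 hx.2
    have hcut := Faces.of_sub_sum_cells_mem_relations Fc C' R hRd hRi hcov hdisj
    have hmem : ∀ k x, x ∈ (R k).domain → x 0 ∈ J L ∧ x 1 ∈ J k := by
      intro k x hx
      rw [hRd, hFcd, hT, hC'] at hx
      exact ⟨hx.1.1, hx.2⟩
    -- zero columns
    have hzero : ∀ k, ((![-Complex.I, 1, Complex.I, -1, -Complex.I, 1] : Fin 6 → ℂ) k).re = 0 →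
        KZ.of (R k) ∈ KZ.relations := by
      intro k hk
      refine KZ.of_mem_relations_of_eqOn_zero _ fun x hx => ?_
      obtain ⟨-, h1⟩ := hmem k x hx
      rw [hRi, hFci]
      simp only [Pi.zero_apply]
      rw [Faces.re_kernel_col e he Φ hΦ J hJ f hf ρ hρ h1, hk, zero_mul]
    -- the columns `J_L × J_k`, `k` odd, are `± P_{Lk}`
    have hcross : ∀ (k : Fin 6) (q : KZ.IntegralRep 2),
        q.domain = {x | x 0 ∈ J L ∧ x 1 ∈ J k} → q.integrand = f →
        ((((![-Complex.I, 1, Complex.I, -1, -Complex.I, 1] : Fin 6 → ℂ) k).re = 1 →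
          KZ.of (R k) - KZ.of q ∈ KZ.relations) ∧
        (((![-Complex.I, 1, Complex.I, -1, -Complex.I, 1] : Fin 6 → ℂ) k).re = -1 →
          KZ.of (R k) + KZ.of q ∈ KZ.relations)) := by
      intro k q hqd hqi
      have hdom : q.domain = (R k).domain := by
        rw [hqd, hRd, hFcd, hT, hC']
        ext x
        simp only [mem_setOf_eq, mem_inter_iff]
        constructor
        · intro hx
          exact ⟨⟨hx.1, fun i => Faces.gap_ne e he J hJ hx.2 i⟩, hx.2⟩
        · intro hx
          exact ⟨hx.1.1, hx.2⟩
      refine ⟨fun hs => KZ.of_sub_of_mem_relations_of_eqOn hdom fun x hx => ?_,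
        fun hs => KZ.of_add_of_mem_relations_of_eqOn_neg hdom fun x hx => ?_⟩
      · obtain ⟨-, h1⟩ := hmem k x hx
        rw [hRi, hFci, hqi]
        simp only
        rw [Faces.re_kernel_col e he Φ hΦ J hJ f hf ρ hρ h1, hs, one_mul]
      · obtain ⟨-, h1⟩ := hmem k x hx
        rw [hRi, hFci, hqi]
        simp only [Pi.neg_apply]
        rw [Faces.re_kernel_col e he Φ hΦ J hJ f hf ρ hρ h1, hs]
        ring
    have r0 := hzero 0 (by simp)
    have r2 := hzero 2 (by simp)
    have r4 := hzero 4 (by simp)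
    have r1 := (hcross 1 q1 hq1.1 hq1.2).1 (by simp)
    have r3 := (hcross 3 q3 hq3.1 hq3.2).2 (by simp)
    have r5 := (hcross 5 q5 hq5.1 hq5.2).1 (by simp)
    have key : KZ.of Fc - (KZ.of q1 - KZ.of q3 + KZ.of q5) =
        (KZ.of Fc - ∑ k, KZ.of (R k)) + KZ.of (R 0) + KZ.of (R 2) + KZ.of (R 4) +
          (KZ.of (R 1) - KZ.of q1) + (KZ.of (R 3) + KZ.of q3) + (KZ.of (R 5) - KZ.of q5) := by
      rw [Fin.sum_univ_six]
      abel
    rw [key]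
    exact KZ.relations.add_mem (KZ.relations.add_mem (KZ.relations.add_mem (KZ.relations.add_mem
      (KZ.relations.add_mem (KZ.relations.add_mem hcut r0) r2) r4) r1) r3) r5

end Summit.KontsevichZagierPeriods.UnfoldedStokes.HyperellipticRiemannRelationLine
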